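import Mathlib
import Summits.CriticalPhenomena.PercolationContinuityZ3.Theorems.PercNearOneGluingNearOneGluingMaxattGlue
import Summits.CriticalPhenomena.PercolationContinuityZ3.Theorems.PercNearOneGluingNearOneGluingMaxattTwo
import Literature.Probability.LatticeModels.ProdBernoulliIndependence
import Literature.Probability.Percolation.PercolationEvents
import Literature.Probability.Percolation.Crossings
import HarnessLib

/-!
# GL3 implies MAXATT

Stub `stub_maxattOfGl3` of line `SketchR2I5` (cycle 4) for the crux `PercNearOneGluing.NearOneGluing`
(item stmt-CriticalPhenomena-4574 = Kozma–Nitzan Conjecture 3 over all finite weighted graphs).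

Setting: one finite weighted graph — vertices `Fin n`, weights `w`, `μ = prodBernoulli w` on bond
configurations `ω : Set (Sym2 (Fin n))`; relay set `A`, source `o ∉ A`, target `b ∈ A`;
`u(a) := μ(a ↮ b) = μ.real (openConn a b)ᶜ`, `r(a) := μ(a ↔ b) = 1 - u(a)`; attachment events
`Att a := openConnIn (insert a (↑A)ᶜ) o a`; lexicographic selection events
`Sel_T a := Att a ∩ {every attached a' ∈ T has (u a', a') ≤ₗₑₓ (u a, a)}` for a family `T`.

* HYPOTHESIS (`stub_gl3`, the generalized Kozma–Nitzan Lemma 3(i), verbatim): for a family `A'` with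
  `o, b, x ∉ A'`, `x` at least as reliable as every member, and `F := {∃ a ∈ A', Att a}` (pockets avoid
  `insert x (insert b A')`): `μ(x ↔ b, F) − r(x) μ(F) ≤ μ(o ↔ b, F) − Σ_{a ∈ A'} r(a) μ(Sel_{A'} a)`.
* CONCLUSION (`stub_maxattGluing`, MAXATT, verbatim): for `o ∉ A ∋ b`,
  `μ{o ↮ b ∧ ∃ a ∈ A, Att a} ≤ Σ_{a ∈ A} u(a) μ(Sel_A a)`.

Proof.  If `A = {b}` the bad event is empty (`Att b ⊆ {o ↔ b}`).  Otherwise let `x` be the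
lexicographic minimum of `a ↦ (u a, a)` on `A.erase b` and `A' := (A.erase b).erase x`, so that
`insert x (insert b A') = A` and GL3 applies to `(A', x)`; write `X := Att x`.  Pointwise: `Att b ⊆ {o ↔ b}`
and on `X`, `o ↔ b ⟺ x ↔ b`; hence `bad = μ(X ∪ F) − μ(o ↔ b, X ∪ F)` and
`μ(o ↔ b, X ∪ F) = μ(x ↔ b, X ∖ F) + μ(o ↔ b, F)`.  Harris (`{x ↔ b}`, `X ∪ F` increasing) and GL3 give
`bad ≤ u(x) μ(X ∖ F) + (μ(F) − Σ_{a ∈ A'} r(a) μ(Sel_{A'} a)) = u(x) μ(X ∖ F) + Σ_{a ∈ A'} u(a) μ(Sel_{A'} a)`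
because the selection events partition `F` (`maxattOfGl3_real_setOf_exists_eq_sum`).  Finally
`X ∖ F ⊆ Sel_A x` and `Sel_{A'} a ⊆ Sel_A a` whenever the `u`-factor in front is nonzero (`u b = 0`, and `x`
is lexicographically below every `a ∈ A'`), and the `b`-term of MAXATT's right side vanishes
(`maxattOfGl3_bookkeeping`).
-/

namespace Summit.CriticalPhenomena.PercolationContinuityZ3.Theorems

open MeasureTheory Set Literature.Probability.LatticeModels Literature.Probability.Percolation
open scoped Classical BigOperators

section MaxattOfGl3

/-- **The lexicographic selection events partition the attachment event.**  With
`Sel a := Att a ∩ {∀ a' ∈ A, Att a' → (u a' < u a ∨ (u a' = u a ∧ a' ≤ a))}` (the attached relay that is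
largest for `(u ·, ·)` in the lexicographic order), `μ{∃ a ∈ A, Att a} = Σ_{a ∈ A} μ(Sel a)`: the events
`Sel a` are pairwise disjoint (`maxattGlue_sel_pairwiseDisjoint`) and every attached configuration selects
the lexicographic maximum of its attached relays. -/
theorem maxattOfGl3_real_setOf_exists_eq_sum {Ω α : Type*} [MeasurableSpace Ω]
    [DiscreteMeasurableSpace Ω] [LinearOrder α] (μ : Measure Ω) [IsFiniteMeasure μ] (A : Finset α)
    (Att : α → Set Ω) (u : α → ℝ) :
    μ.real {ω : Ω | ∃ a ∈ A, ω ∈ Att a} =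
      ∑ a ∈ A, μ.real {ω : Ω | ω ∈ Att a ∧
        ∀ a' ∈ A, ω ∈ Att a' → (u a' < u a ∨ (u a' = u a ∧ a' ≤ a))} := by
  rw [← measureReal_biUnion_finset (maxattGlue_sel_pairwiseDisjoint A Att u)
    (fun _ _ => MeasurableSet.of_discrete)]
  congr 1
  ext ω
  simp only [Set.mem_setOf_eq, Set.mem_iUnion, exists_prop]
  constructor
  · rintro ⟨a, ha, hω⟩
    obtain ⟨m, hm, hmax⟩ := Finset.exists_max_image (A.filter fun a => ω ∈ Att a)
      (fun a => toLex (u a, a)) ⟨a, Finset.mem_filter.2 ⟨ha, hω⟩⟩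
    refine ⟨m, (Finset.mem_filter.1 hm).1, (Finset.mem_filter.1 hm).2, fun a' ha' hω' => ?_⟩
    exact Prod.Lex.toLex_le_toLex.1 (hmax a' (Finset.mem_filter.2 ⟨ha', hω'⟩))
  · rintro ⟨a, ha, hω, -⟩
    exact ⟨a, ha, hω⟩

/-- **Measure bookkeeping for GL3 ⟹ MAXATT** (abstract form: any discrete probability space, events
`Att a` "attached", `B a` "`a ↔ b`", `Bo` "`o ↔ b`", `u a = 1 - μ(B a)`).  Given `b, x ∈ A`, `x ≠ b`,
`u b = 0`, `Att b ⊆ Bo`, `Bo = B x` on `Att x`, `x` lexicographically below every member of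
`A' := (A.erase b).erase x`, Harris for `B x` and `Att x ∪ F` (`F := {∃ a ∈ A', Att a}`) and the GL3
inequality for `(A', x)`, the MAXATT inequality for `A` follows:
`μ{ω ∉ Bo ∧ ∃ a ∈ A, Att a} ≤ Σ_{a ∈ A} u(a) μ(Sel_A a)`. -/
theorem maxattOfGl3_bookkeeping {Ω α : Type*} [MeasurableSpace Ω] [DiscreteMeasurableSpace Ω]
    [LinearOrder α] (μ : Measure Ω) [IsFiniteMeasure μ] (A : Finset α) (b x : α) (Att B : α → Set Ω)
    (Bo : Set Ω) (u : α → ℝ) (hb : b ∈ A) (hxA : x ∈ A) (hxb : x ≠ b)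
    (hu : ∀ a, μ.real (B a) = 1 - u a) (hu0 : ∀ a, 0 ≤ u a) (hub : u b = 0) (hAttb : Att b ⊆ Bo)
    (hXo : ∀ ω ∈ Att x, ω ∈ Bo ↔ ω ∈ B x)
    (hmin : ∀ a ∈ (A.erase b).erase x, u x < u a ∨ (u x = u a ∧ x ≤ a))
    (hharris : μ.real (B x) * μ.real (Att x ∪ {ω | ∃ a ∈ (A.erase b).erase x, ω ∈ Att a}) ≤
      μ.real (B x ∩ (Att x ∪ {ω | ∃ a ∈ (A.erase b).erase x, ω ∈ Att a})))
    (hgl : μ.real (B x ∩ {ω | ∃ a ∈ (A.erase b).erase x, ω ∈ Att a}) -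
        μ.real (B x) * μ.real {ω | ∃ a ∈ (A.erase b).erase x, ω ∈ Att a} ≤
      μ.real (Bo ∩ {ω | ∃ a ∈ (A.erase b).erase x, ω ∈ Att a}) -
        ∑ a ∈ (A.erase b).erase x, μ.real (B a) *
          μ.real {ω | ω ∈ Att a ∧ ∀ a' ∈ (A.erase b).erase x, ω ∈ Att a' →
            (u a' < u a ∨ (u a' = u a ∧ a' ≤ a))}) :
    μ.real {ω | ω ∉ Bo ∧ ∃ a ∈ A, ω ∈ Att a} ≤
      ∑ a ∈ A, u a * μ.real {ω | ω ∈ Att a ∧ ∀ a' ∈ A, ω ∈ Att a' →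
        (u a' < u a ∨ (u a' = u a ∧ a' ≤ a))} := by
  -- notation
  set A' := (A.erase b).erase x with hA'
  set F : Set Ω := {ω | ∃ a ∈ A', ω ∈ Att a} with hF
  set X : Set Ω := Att x with hX
  have hm : ∀ s : Set Ω, MeasurableSet s := fun s => MeasurableSet.of_discrete
  have hmemA' : ∀ {a}, a ∈ A' ↔ a ≠ x ∧ a ≠ b ∧ a ∈ A := fun {a} => by
    rw [hA', Finset.mem_erase, Finset.mem_erase]
  have hx0 : x ∈ A.erase b := Finset.mem_erase.2 ⟨hxb, hxA⟩
  -- (1) the bad event: the attached witness is `x`, or lies in `A'` (`b` attached forces `Bo`)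
  have hbad_eq : {ω | ω ∉ Bo ∧ ∃ a ∈ A, ω ∈ Att a} = (X ∪ F) \ (Bo ∩ (X ∪ F)) := by
    ext ω
    simp only [Set.mem_setOf_eq, Set.mem_sdiff, Set.mem_union, Set.mem_inter_iff]
    constructor
    · rintro ⟨hBo, a, ha, hω⟩
      refine ⟨?_, fun h => hBo h.1⟩
      by_cases hax : a = x
      · rw [hax] at hω
        exact Or.inl hω
      by_cases hab : a = b
      · rw [hab] at hω
        exact absurd (hAttb hω) hBo
      exact Or.inr ⟨a, hmemA'.2 ⟨hax, hab, ha⟩, hω⟩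
    · rintro ⟨hXF, hnot⟩
      refine ⟨fun hBo => hnot ⟨hBo, hXF⟩, ?_⟩
      rcases hXF with hx | ⟨a, ha, hω⟩
      · exact ⟨x, hxA, hx⟩
      · exact ⟨a, (hmemA'.1 ha).2.2, hω⟩
  -- (2) measure identities
  have hbad : μ.real {ω | ω ∉ Bo ∧ ∃ a ∈ A, ω ∈ Att a} =
      μ.real (X ∪ F) - μ.real (Bo ∩ (X ∪ F)) := by
    rw [hbad_eq, measureReal_sdiff Set.inter_subset_right (hm _)]
  have hXF : μ.real (X ∪ F) = μ.real (X \ F) + μ.real F := by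
    rw [← measureReal_union Set.disjoint_sdiff_left (hm _), Set.sdiff_union_self]
  have hgood : μ.real (Bo ∩ (X ∪ F)) = μ.real (B x ∩ (X \ F)) + μ.real (Bo ∩ F) := by
    have h1 : Bo ∩ (X ∪ F) = (B x ∩ (X \ F)) ∪ (Bo ∩ F) := by
      ext ω
      simp only [Set.mem_inter_iff, Set.mem_union, Set.mem_sdiff]
      constructor
      · rintro ⟨hBo, hx | hf⟩
        · by_cases hf : ω ∈ F
          · exact Or.inr ⟨hBo, hf⟩
          · exact Or.inl ⟨(hXo ω hx).1 hBo, hx, hf⟩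
        · exact Or.inr ⟨hBo, hf⟩
      · rintro (⟨hB, hx, -⟩ | ⟨hBo, hf⟩)
        · exact ⟨(hXo ω hx).2 hB, Or.inl hx⟩
        · exact ⟨hBo, Or.inr hf⟩
    rw [h1, measureReal_union _ (hm _)]
    exact Set.disjoint_left.2 fun ω h1 h2 => h1.2.2 h2.2
  have hxsplit : μ.real (B x ∩ (X ∪ F)) = μ.real (B x ∩ (X \ F)) + μ.real (B x ∩ F) := by
    have h1 : B x ∩ (X ∪ F) = (B x ∩ (X \ F)) ∪ (B x ∩ F) := by
      ext ω
      simp only [Set.mem_inter_iff, Set.mem_union, Set.mem_sdiff]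
      tauto
    rw [h1, measureReal_union _ (hm _)]
    exact Set.disjoint_left.2 fun ω h1 h2 => h1.2.2 h2.2
  -- (3) the selection events partition `F`
  have hpart : μ.real F = ∑ a ∈ A', μ.real {ω | ω ∈ Att a ∧ ∀ a' ∈ A', ω ∈ Att a' →
      (u a' < u a ∨ (u a' = u a ∧ a' ≤ a))} :=
    maxattOfGl3_real_setOf_exists_eq_sum μ A' Att u
  -- (4) the GL3 / Harris bound
  have hbound : μ.real {ω | ω ∉ Bo ∧ ∃ a ∈ A, ω ∈ Att a} ≤
      u x * μ.real (X \ F) + ∑ a ∈ A', u a * μ.real {ω | ω ∈ Att a ∧ ∀ a' ∈ A', ω ∈ Att a' →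
        (u a' < u a ∨ (u a' = u a ∧ a' ≤ a))} := by
    have hsum : ∑ a ∈ A', u a * μ.real {ω | ω ∈ Att a ∧ ∀ a' ∈ A', ω ∈ Att a' →
          (u a' < u a ∨ (u a' = u a ∧ a' ≤ a))} =
        μ.real F - ∑ a ∈ A', μ.real (B a) * μ.real {ω | ω ∈ Att a ∧ ∀ a' ∈ A', ω ∈ Att a' →
          (u a' < u a ∨ (u a' = u a ∧ a' ≤ a))} := by
      rw [hpart, ← Finset.sum_sub_distrib]
      refine Finset.sum_congr rfl fun a _ => ?_
      rw [hu a]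
      ring
    rw [hbad, hsum, hgood]
    have e1 : μ.real (B x) * μ.real (X ∪ F) =
        μ.real (B x) * μ.real (X \ F) + μ.real (B x) * μ.real F := by
      rw [hXF]
      ring
    have e2 : u x * μ.real (X \ F) = μ.real (X \ F) - μ.real (B x) * μ.real (X \ F) := by
      rw [hu x]
      ring
    linarith [hharris, hgl, hxsplit, hXF, e1, e2]
  -- (5) comparison with MAXATT's right side
  have h1 : u x * μ.real (X \ F) ≤ u x * μ.real {ω | ω ∈ Att x ∧ ∀ a' ∈ A, ω ∈ Att a' →
      (u a' < u x ∨ (u a' = u x ∧ a' ≤ x))} := by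
    rcases (hu0 x).eq_or_lt with hux | hux
    · rw [← hux, zero_mul, zero_mul]
    · refine mul_le_mul_of_nonneg_left (measureReal_mono ?_ (measure_ne_top _ _)) (hu0 x)
      rintro ω ⟨hx, hf⟩
      refine ⟨hx, fun a' ha' hω' => ?_⟩
      by_cases hax : a' = x
      · exact Or.inr ⟨by rw [hax], by rw [hax]⟩
      by_cases hab : a' = b
      · left
        rw [hab, hub]
        exact hux
      exact absurd ⟨a', hmemA'.2 ⟨hax, hab, ha'⟩, hω'⟩ hf
  have h2 : ∀ a ∈ A', u a * μ.real {ω | ω ∈ Att a ∧ ∀ a' ∈ A', ω ∈ Att a' →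
        (u a' < u a ∨ (u a' = u a ∧ a' ≤ a))} ≤
      u a * μ.real {ω | ω ∈ Att a ∧ ∀ a' ∈ A, ω ∈ Att a' →
        (u a' < u a ∨ (u a' = u a ∧ a' ≤ a))} := by
    intro a ha
    rcases (hu0 a).eq_or_lt with hua | hua
    · rw [← hua, zero_mul, zero_mul]
    · refine mul_le_mul_of_nonneg_left (measureReal_mono ?_ (measure_ne_top _ _)) (hu0 a)
      rintro ω ⟨hatt, hsel⟩
      refine ⟨hatt, fun a' ha' hω' => ?_⟩
      by_cases hax : a' = x
      · rw [hax]
        exact hmin a ha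
      by_cases hab : a' = b
      · left
        rw [hab, hub]
        exact hua
      exact hsel a' (hmemA'.2 ⟨hax, hab, ha'⟩) hω'
  calc μ.real {ω | ω ∉ Bo ∧ ∃ a ∈ A, ω ∈ Att a}
      ≤ u x * μ.real (X \ F) + ∑ a ∈ A', u a * μ.real {ω | ω ∈ Att a ∧ ∀ a' ∈ A', ω ∈ Att a' →
          (u a' < u a ∨ (u a' = u a ∧ a' ≤ a))} := hbound
    _ ≤ u x * μ.real {ω | ω ∈ Att x ∧ ∀ a' ∈ A, ω ∈ Att a' →
          (u a' < u x ∨ (u a' = u x ∧ a' ≤ x))} +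
        ∑ a ∈ A', u a * μ.real {ω | ω ∈ Att a ∧ ∀ a' ∈ A, ω ∈ Att a' →
          (u a' < u a ∨ (u a' = u a ∧ a' ≤ a))} := add_le_add h1 (Finset.sum_le_sum h2)
    _ = ∑ a ∈ A, u a * μ.real {ω | ω ∈ Att a ∧ ∀ a' ∈ A, ω ∈ Att a' →
          (u a' < u a ∨ (u a' = u a ∧ a' ≤ a))} := by
      rw [← Finset.add_sum_erase A _ hb, ← Finset.add_sum_erase (A.erase b) _ hx0, hub, zero_mul,
        zero_add]

end MaxattOfGl3

/-- **GL3 implies MAXATT** (stub `stub_maxattOfGl3` of line `SketchR2I5`, cycle 4).  The hypothesis is the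
generalized Kozma–Nitzan Lemma 3(i) `stub_gl3` verbatim, the conclusion the MAXATT inequality
`stub_maxattGluing` verbatim.  For `o ∉ A ∋ b`: if `A = {b}` the bad event is empty; otherwise apply GL3 to
the family `A' := (A.erase b).erase x` and the outsider `x :=` the lexicographic minimum of `a ↦ (μ(a ↮ b), a)`
on `A.erase b` (`insert x (insert b A') = A`), Harris for `{x ↔ b}` and `Att x ∪ F`, and the bookkeeping
`maxattOfGl3_bookkeeping`. -/
theorem stub_maxattOfGl3 :
    (∀ (n : ℕ) (w : Sym2 (Fin n) → unitInterval) (A : Finset (Fin n)) (o b x : Fin n), o ∉ A → b ∉ A → x ∉ A →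
      (∀ a ∈ A, (prodBernoulli w).real (openConn a b) ≤ (prodBernoulli w).real (openConn x b)) →
      (prodBernoulli w).real (openConn x b ∩
          {ω | ∃ a ∈ A, ω ∈ openConnIn (insert a ((↑(insert x (insert b A)) : Set (Fin n))ᶜ)) o a}) -
        (prodBernoulli w).real (openConn x b) *
          (prodBernoulli w).real {ω | ∃ a ∈ A, ω ∈ openConnIn (insert a ((↑(insert x (insert b A)) : Set (Fin n))ᶜ)) o a} ≤
      (prodBernoulli w).real (openConn o b ∩
          {ω | ∃ a ∈ A, ω ∈ openConnIn (insert a ((↑(insert x (insert b A)) : Set (Fin n))ᶜ)) o a}) -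
        ∑ a ∈ A, (prodBernoulli w).real (openConn a b) *
          (prodBernoulli w).real {ω | ω ∈ openConnIn (insert a ((↑(insert x (insert b A)) : Set (Fin n))ᶜ)) o a ∧
            ∀ a' ∈ A, ω ∈ openConnIn (insert a' ((↑(insert x (insert b A)) : Set (Fin n))ᶜ)) o a' →
              ((prodBernoulli w).real (openConn a' b)ᶜ < (prodBernoulli w).real (openConn a b)ᶜ ∨
                ((prodBernoulli w).real (openConn a' b)ᶜ = (prodBernoulli w).real (openConn a b)ᶜ ∧ a' ≤ a))}) →
    (∀ (n : ℕ) (w : Sym2 (Fin n) → unitInterval) (A : Finset (Fin n)) (o b : Fin n), o ∉ A → b ∈ A →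
      (prodBernoulli w).real {ω | ω ∉ openConn o b ∧
          ∃ a ∈ A, ω ∈ openConnIn (insert a ((↑A : Set (Fin n))ᶜ)) o a} ≤
        ∑ a ∈ A, (prodBernoulli w).real (openConn a b)ᶜ *
          (prodBernoulli w).real {ω | ω ∈ openConnIn (insert a ((↑A : Set (Fin n))ᶜ)) o a ∧
            ∀ a' ∈ A, ω ∈ openConnIn (insert a' ((↑A : Set (Fin n))ᶜ)) o a' →
              ((prodBernoulli w).real (openConn a' b)ᶜ < (prodBernoulli w).real (openConn a b)ᶜ ∨
                ((prodBernoulli w).real (openConn a' b)ᶜ = (prodBernoulli w).real (openConn a b)ᶜ ∧ a' ≤ a))}) := by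
  intro hGL n w A o b ho hb
  have hm : ∀ s : Set (BondConfig (Fin n)), MeasurableSet s := fun s => MeasurableSet.of_discrete
  -- the case `A = {b}`: the bad event is empty
  by_cases hne : (A.erase b).Nonempty
  swap
  · have hAb : ∀ a ∈ A, a = b := fun a ha =>
      by_contra fun hab => hne ⟨a, Finset.mem_erase.2 ⟨hab, ha⟩⟩
    have hempty : {ω : BondConfig (Fin n) | ω ∉ openConn o b ∧
        ∃ a ∈ A, ω ∈ openConnIn (insert a ((↑A : Set (Fin n))ᶜ)) o a} = ∅ := by
      refine Set.eq_empty_of_forall_notMem fun ω hω => hω.1 ?_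
      obtain ⟨a, ha, hωa⟩ := hω.2
      rw [hAb a ha] at hωa
      exact maxattTwo_openConn_of_openConnIn hωa
    rw [hempty, measureReal_empty]
    exact Finset.sum_nonneg fun a _ => mul_nonneg measureReal_nonneg measureReal_nonneg
  -- the lexicographically minimal relay `x` of `A.erase b` for the key `a ↦ (μ(a ↮ b), a)`
  obtain ⟨x, hx0, hxmin⟩ := Finset.exists_min_image (A.erase b)
    (fun a => toLex ((prodBernoulli w).real (openConn a b)ᶜ, a)) hne
  have hxb : x ≠ b := (Finset.mem_erase.1 hx0).1
  have hxA : x ∈ A := (Finset.mem_erase.1 hx0).2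
  have hmemA' : ∀ {a}, a ∈ (A.erase b).erase x ↔ a ≠ x ∧ a ≠ b ∧ a ∈ A := fun {a} => by
    rw [Finset.mem_erase, Finset.mem_erase]
  have hoA' : o ∉ (A.erase b).erase x := fun h => ho (hmemA'.1 h).2.2
  have hbA' : b ∉ (A.erase b).erase x := fun h => (hmemA'.1 h).2.1 rfl
  have hxA' : x ∉ (A.erase b).erase x := fun h => (hmemA'.1 h).1 rfl
  have hAeq : insert x (insert b ((A.erase b).erase x)) = A := by
    ext a
    simp only [Finset.mem_insert]
    constructor
    · rintro (rfl | rfl | ha)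
      exacts [hxA, hb, (hmemA'.1 ha).2.2]
    · intro ha
      by_cases hax : a = x
      · exact Or.inl hax
      by_cases hab : a = b
      · exact Or.inr (Or.inl hab)
      exact Or.inr (Or.inr (hmemA'.2 ⟨hax, hab, ha⟩))
  -- `r = 1 - u`, the order hypotheses
  have hu : ∀ a, (prodBernoulli w).real (openConn a b) = 1 - (prodBernoulli w).real (openConn a b)ᶜ := by
    intro a
    rw [probReal_compl_eq_one_sub (hm _)]
    ring
  have hmin : ∀ a ∈ (A.erase b).erase x,
      (prodBernoulli w).real (openConn x b)ᶜ < (prodBernoulli w).real (openConn a b)ᶜ ∨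
        ((prodBernoulli w).real (openConn x b)ᶜ = (prodBernoulli w).real (openConn a b)ᶜ ∧ x ≤ a) :=
    fun a ha => Prod.Lex.toLex_le_toLex.1
      (hxmin a (Finset.mem_erase.2 ⟨(hmemA'.1 ha).2.1, (hmemA'.1 ha).2.2⟩))
  have hord : ∀ a ∈ (A.erase b).erase x,
      (prodBernoulli w).real (openConn a b) ≤ (prodBernoulli w).real (openConn x b) := by
    intro a ha
    have ha' := hu a
    have hx' := hu x
    rcases hmin a ha with h | ⟨h, -⟩ <;> linarith
  -- GL3 for the family `A'` and the outsider `x`; its pockets are MAXATT's (`insert x (insert b A') = A`)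
  have hgl := hGL n w ((A.erase b).erase x) o b x hoA' hbA' hxA' hord
  rw [hAeq] at hgl
  -- pointwise facts and Harris
  have hAttb : (openConnIn (insert b ((↑A : Set (Fin n))ᶜ)) o b : Set (BondConfig (Fin n))) ⊆ openConn o b :=
    fun ω hω => maxattTwo_openConn_of_openConnIn hω
  have hXo : ∀ ω ∈ (openConnIn (insert x ((↑A : Set (Fin n))ᶜ)) o x : Set (BondConfig (Fin n))),
      ω ∈ (openConn o b : Set (BondConfig (Fin n))) ↔ ω ∈ (openConn x b : Set (BondConfig (Fin n))) := by
    intro ω hω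
    have hox : (openGraph ω).Reachable o x := maxattTwo_openConn_of_openConnIn hω
    exact ⟨fun h => hox.symm.trans h, fun h => hox.trans h⟩
  have hub : (prodBernoulli w).real (openConn b b : Set (BondConfig (Fin n)))ᶜ = 0 := by
    have hempty : (openConn b b : Set (BondConfig (Fin n)))ᶜ = ∅ :=
      Set.compl_empty_iff.2 (Set.eq_univ_of_forall fun _ => SimpleGraph.Reachable.refl _)
    rw [hempty, measureReal_empty]
  have hF : IsUpperSet {ω : BondConfig (Fin n) | ∃ a ∈ (A.erase b).erase x,
      ω ∈ openConnIn (insert a ((↑A : Set (Fin n))ᶜ)) o a} :=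
    fun ω ω' hle ⟨a, ha, hω⟩ => ⟨a, ha, isUpperSet_openConnIn _ o a hle hω⟩
  have hharris := prodBernoulli_harris w (isUpperSet_openConn x b)
    ((isUpperSet_openConnIn (insert x ((↑A : Set (Fin n))ᶜ)) o x).union hF) (hm _) (hm _)
  exact maxattOfGl3_bookkeeping (prodBernoulli w) A b x
    (fun a => openConnIn (insert a ((↑A : Set (Fin n))ᶜ)) o a) (fun a => openConn a b) (openConn o b)
    (fun a => (prodBernoulli w).real (openConn a b)ᶜ) hb hxA hxb hu (fun a => measureReal_nonneg) hub
    hAttb hXo hmin hharris hgl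

end Summit.CriticalPhenomena.PercolationContinuityZ3.Theorems
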